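import Mathlib
import Literature.NumberTheory.Transcendental.KZCalculus
import Literature.NumberTheory.Transcendental.KZLogCalculusProofs
import Literature.NumberTheory.Transcendental.KZSemialgebraicComplex
import Literature.NumberTheory.Transcendental.SemialgebraicMapsProofs
import Literature.NumberTheory.Transcendental.SemialgebraicRpow
import Literature.NumberTheory.Transcendental.EllIterRep
import Summits.KontsevichZagierPeriods.KontsevichZagierPeriods.Theses.TorsionLogs

/-!
# Route TorsionLogs — support item `GKZLevelThreePair`: the T-chain, step (N3)
# (ONE Newton–Leibniz move: `[band, (3/2)(1+x)/(x√x √(1-s²))] ∼ [(0,1), 3(m^{-1/3}-m^{1/3})/√(1-s²)]`)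

Helper file for item `stmt-KontsevichZagierPeriods-13812` (`GKZLevelThreePair`), blueprint v3. In the
hyperelliptic chart `x³ = (1-t)/(t(1-y²t))`, `Y² = x⁶ + 2(1-2y²)x³ + 1`, followed by the affine chart
`y = s(x³+1)/(2x√x)` (under which `Y = (x³+1)√(1-s²)`), the 2-dimensional factor `Trep` of the
level-3 Euler representation (value `T = 6 log 2`) becomes the band representation

  `Rb = [ {0 < s < 1, x₋(s) ≤ x ≤ 1}, (3/2)(1+x)/(x√x · √(1-s²)) ]`,  `x₋(s) = m(s)^{2/3}`,
  `m(s) = (1 - √(1-s²))/s`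

(`x₋(s)` is the smaller root of `2x√x/(1+x³) = s`). Its integrand is the `x`-derivative of the
ALGEBRAIC primitive `F(s, x) = 3(√x - 1/√x)/√(1-s²)`, so ONE instance of Kontsevich–Zagier's rule 3)
(Newton–Leibniz along the last coordinate over the base `(0,1) ∋ s`, `KZ.newtonLeibnizRel`) gives

  `Rb ∼ R4 = [ (0,1), 3(m(s)^{-1/3} - m(s)^{1/3})/√(1-s²) ]`   (`band_equivalent_tail4`),

since `F(s,1) = 0` and `√(x₋(s)) = m(s)^{1/3}`. Both representations are PINNED by their domain and
their integrand on it (their existence is proved where the chain is assembled).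

## References

* M. Kontsevich, D. Zagier, *Periods* (2001), §1.2 rule (3) ("Newton–Leibniz").
-/

-- `Summit.<Summit>.<Sub>` with Sub = Summit (single-conjunct summit, D-0017) duplicates the segment.
set_option linter.dupNamespace false

noncomputable section

namespace Summit.KontsevichZagierPeriods.KontsevichZagierPeriods.Theorems.GKZLevelThree

open Set MeasureTheory
open MvPolynomial (aeval X C)
open Literature.NumberTheory.Transcendental Literature.NumberTheory.Transcendental.KZ
open Literature.ModelTheory.ExponentialFields (IsSemialgebraic isSemialgebraic_setOf_eval_pos)

/-! ## The lower limit `x₋(s) = m(s)^{2/3}`, `m(s) = (1-√(1-s²))/s` -/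

/-- For `0 < s < 1`: `0 < √(1-s²) < 1`. -/
theorem sqrt_one_sub_sq_mem {s : ℝ} (hs0 : 0 < s) (hs1 : s < 1) :
    0 < Real.sqrt (1 - s ^ 2) ∧ Real.sqrt (1 - s ^ 2) < 1 := by
  refine ⟨Real.sqrt_pos.2 (by nlinarith), ?_⟩
  rw [Real.sqrt_lt' one_pos]
  nlinarith

/-- For `0 < s < 1`: `0 < m(s) ≤ 1` where `m(s) = (1-√(1-s²))/s`. -/
theorem tailRoot_pos_le_one {s : ℝ} (hs0 : 0 < s) (hs1 : s < 1) :
    0 < (1 - Real.sqrt (1 - s ^ 2)) / s ∧ (1 - Real.sqrt (1 - s ^ 2)) / s ≤ 1 := by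
  obtain ⟨hq0, hq1⟩ := sqrt_one_sub_sq_mem hs0 hs1
  refine ⟨div_pos (by linarith) hs0, ?_⟩
  rw [div_le_one hs0]
  -- `1 - s ≤ √(1 - s²)`
  have h : 1 - s ≤ Real.sqrt (1 - s ^ 2) := by
    rw [Real.le_sqrt (by linarith) (by nlinarith)]
    nlinarith
  linarith

/-- `√(m^{2/3}) = m^{1/3}` and `(√(m^{2/3}))⁻¹ = m^{-1/3}` for `m > 0`. -/
theorem sqrt_rpow_two_thirds {m : ℝ} (hm : 0 < m) :
    Real.sqrt (m ^ ((2:ℝ) / 3)) = m ^ ((1:ℝ) / 3) ∧ (Real.sqrt (m ^ ((2:ℝ) / 3)))⁻¹ = m ^ (-(1:ℝ) / 3) := by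
  have h1 : Real.sqrt (m ^ ((2:ℝ) / 3)) = m ^ ((1:ℝ) / 3) := by
    rw [Real.sqrt_eq_rpow, ← Real.rpow_mul hm.le]
    norm_num
  refine ⟨h1, ?_⟩
  rw [h1, ← Real.rpow_neg hm.le]
  norm_num

/-! ## The Newton–Leibniz move -/

/-- **Step (N3): ONE Newton–Leibniz move.** For the band representation `Rb` and the tail `R4`
pinned as in the module docstring, `Rb ∼ R4`: rule 3) along the last coordinate `x` over the base
`(0,1) ∋ s`, with bounds `a(s) = m(s)^{2/3} ≤ b(s) = 1` (both `ℚ`-semialgebraic) and the primitive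
`F(s,x) = 3(√x - 1/√x)/√(1-s²)`, which is `ℚ`-semialgebraic on the band, continuous on each closed
fibre `[a(s), 1]` and has `x`-derivative `(3/2)(1+x)/(x√x√(1-s²))` on the open fibre; and
`F(s,1) - F(s,a(s)) = 3(m^{-1/3} - m^{1/3})/√(1-s²)`. [Kontsevich–Zagier 2001, §1.2 rule (3)] -/
theorem band_equivalent_tail4 (Rb : IntegralRep 2) (R₄ : IntegralRep 1)
    (hbd : Rb.domain = {z | (Fin.init z : Fin 1 → ℝ) ∈ {p : Fin 1 → ℝ | 0 < p 0 ∧ p 0 < 1} ∧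
      ((1 - Real.sqrt (1 - (Fin.init z) 0 ^ 2)) / (Fin.init z) 0) ^ ((2:ℝ) / 3) ≤ z (Fin.last 1) ∧
      z (Fin.last 1) ≤ 1})
    (hbi : EqOn Rb.integrand (fun z => 3 / 2 * (1 + z 1) / (z 1 * Real.sqrt (z 1) * Real.sqrt (1 - z 0 ^ 2)))
      Rb.domain)
    (h4d : R₄.domain = {x : Fin 1 → ℝ | 0 < x 0 ∧ x 0 < 1})
    (h4i : EqOn R₄.integrand (fun x => 3 * (((1 - Real.sqrt (1 - x 0 ^ 2)) / x 0) ^ (-(1:ℝ) / 3) -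
      ((1 - Real.sqrt (1 - x 0 ^ 2)) / x 0) ^ ((1:ℝ) / 3)) / Real.sqrt (1 - x 0 ^ 2)) R₄.domain) :
    Equivalent Rb R₄ := by
  -- notation
  set m : ℝ → ℝ := fun s => (1 - Real.sqrt (1 - s ^ 2)) / s with hm
  set a : (Fin 1 → ℝ) → ℝ := fun p => (m (p 0)) ^ ((2:ℝ) / 3) with ha
  set b : (Fin 1 → ℝ) → ℝ := fun _ => 1 with hb
  set F : (Fin 2 → ℝ) → ℝ := fun z => 3 * (Real.sqrt (z 1) - (Real.sqrt (z 1))⁻¹) / Real.sqrt (1 - z 0 ^ 2)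
    with hF
  have hinit : ∀ z : Fin 2 → ℝ, (Fin.init z) 0 = z 0 := fun z => rfl
  have hlast : (Fin.last 1 : Fin 2) = 1 := rfl
  have hsnoc0 : ∀ (p : Fin 1 → ℝ) (t : ℝ), (Fin.snoc p t : Fin 2 → ℝ) 0 = p 0 := fun p t => by
    simp [Fin.snoc]
  have hsnoc1 : ∀ (p : Fin 1 → ℝ) (t : ℝ), (Fin.snoc p t : Fin 2 → ℝ) 1 = t := fun p t => by
    simp [Fin.snoc]
  -- facts on the base
  have hbase : ∀ p ∈ R₄.domain, 0 < p 0 ∧ p 0 < 1 := fun p hp => by rw [h4d] at hp; exact hp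
  have hm01 : ∀ p ∈ R₄.domain, 0 < m (p 0) ∧ m (p 0) ≤ 1 := fun p hp =>
    tailRoot_pos_le_one (hbase p hp).1 (hbase p hp).2
  have ha01 : ∀ p ∈ R₄.domain, 0 < a p ∧ a p ≤ 1 := fun p hp => by
    obtain ⟨h0, h1⟩ := hm01 p hp
    exact ⟨Real.rpow_pos_of_pos h0 _, Real.rpow_le_one h0.le h1 (by norm_num)⟩
  have hsq : ∀ p ∈ R₄.domain, 0 < Real.sqrt (1 - p 0 ^ 2) := fun p hp =>
    (sqrt_one_sub_sq_mem (hbase p hp).1 (hbase p hp).2).1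
  -- membership in the band
  have hmem : ∀ z : Fin 2 → ℝ, z ∈ Rb.domain ↔ (0 < z 0 ∧ z 0 < 1) ∧ a (Fin.init z) ≤ z 1 ∧ z 1 ≤ 1 := by
    intro z
    rw [hbd]
    simp only [mem_setOf_eq, hinit, hlast, ha, hm]
  -- (1) the primitive is semialgebraic on the band
  have hsa_dom : IsSemialgebraic ℚ Rb.domain := Rb.isSemialgebraic_domain
  have hz1pos : ∀ z ∈ Rb.domain, 0 < z 1 := fun z hz => by
    obtain ⟨hz0, hz1, -⟩ := (hmem z).1 hz
    have := (ha01 (Fin.init z) (by rw [h4d]; exact hz0)).1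
    linarith
  have hz0 : ∀ z ∈ Rb.domain, 0 < z 0 ∧ z 0 < 1 := fun z hz => ((hmem z).1 hz).1
  have hFsa : IsSemialgebraicFunOn ℚ Rb.domain F := by
    have hX1 : IsSemialgebraicFunOn ℚ Rb.domain (fun z => z 1) :=
      (isSemialgebraicFunOn_aeval hsa_dom (X 1 : MvPolynomial (Fin 2) ℚ)).congr fun z _ => by simp
    have hs1 : IsSemialgebraicFunOn ℚ Rb.domain (fun z => Real.sqrt (z 1)) := IsSemialgebraicFunOn.sqrt_holds hX1
    have hinv : IsSemialgebraicFunOn ℚ Rb.domain (fun z => (Real.sqrt (z 1))⁻¹) :=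
      hs1.inv fun z hz => (Real.sqrt_pos.2 (hz1pos z hz)).ne'
    have h1z : IsSemialgebraicFunOn ℚ Rb.domain (fun z => 1 - z 0 ^ 2) :=
      (isSemialgebraicFunOn_aeval hsa_dom (1 - X 0 ^ 2 : MvPolynomial (Fin 2) ℚ)).congr fun z _ => by simp
    have hs0 : IsSemialgebraicFunOn ℚ Rb.domain (fun z => Real.sqrt (1 - z 0 ^ 2)) := IsSemialgebraicFunOn.sqrt_holds h1z
    have h3 : IsSemialgebraicFunOn ℚ Rb.domain (fun _ => (3:ℝ)) := by
      simpa using isSemialgebraicFunOn_const_of_isAlgebraic hsa_dom (isAlgebraic_nat (R := ℚ) (A := ℝ) 3)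
    refine ((IsSemialgebraicFunOn.mul_holds h3 (IsSemialgebraicFunOn.sub_holds hs1 hinv)).div hs0
      fun z hz => ?_).congr fun z _ => by simp [hF]
    exact (sqrt_one_sub_sq_mem (hz0 z hz).1 (hz0 z hz).2).1.ne'
  -- (2), (3) the bounds are semialgebraic on the base
  have hsa4 : IsSemialgebraic ℚ R₄.domain := R₄.isSemialgebraic_domain
  have hasa : IsSemialgebraicFunOn ℚ R₄.domain a := by
    have hX : IsSemialgebraicFunOn ℚ R₄.domain (fun p => p 0) :=
      (isSemialgebraicFunOn_aeval hsa4 (X 0 : MvPolynomial (Fin 1) ℚ)).congr fun z _ => by simp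
    have h1s : IsSemialgebraicFunOn ℚ R₄.domain (fun p => 1 - p 0 ^ 2) :=
      (isSemialgebraicFunOn_aeval hsa4 (1 - X 0 ^ 2 : MvPolynomial (Fin 1) ℚ)).congr fun z _ => by simp
    have hsq' : IsSemialgebraicFunOn ℚ R₄.domain (fun p => Real.sqrt (1 - p 0 ^ 2)) :=
      IsSemialgebraicFunOn.sqrt_holds h1s
    have hone : IsSemialgebraicFunOn ℚ R₄.domain (fun _ => (1:ℝ)) := by
      simpa using isSemialgebraicFunOn_const_of_isAlgebraic hsa4 isAlgebraic_one
    have hmsa : IsSemialgebraicFunOn ℚ R₄.domain (fun p => m (p 0)) :=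
      ((IsSemialgebraicFunOn.sub_holds hone hsq').div hX fun p hp => (hbase p hp).1.ne').congr
        fun p _ => by simp [hm]
    exact (hmsa.rpow_ratCast hsa4 (fun p hp => (hm01 p hp).1) (2 / 3)).congr fun p _ => by
      norm_num [ha]
  have hbsa : IsSemialgebraicFunOn ℚ R₄.domain b := by
    simpa [hb] using isSemialgebraicFunOn_const_of_isAlgebraic hsa4 isAlgebraic_one
  -- (6) continuity of the primitive on the closed fibres, (7) its derivative on the open fibres
  have hcont : ∀ p ∈ R₄.domain, ContinuousOn (fun t : ℝ => F (Fin.snoc p t)) (Icc (a p) (b p)) := by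
    intro p hp
    have hap := (ha01 p hp).1
    simp only [hF, hsnoc0, hsnoc1]
    refine ContinuousOn.div ?_ continuousOn_const fun t _ => (hsq p hp).ne'
    refine continuousOn_const.mul (Real.continuous_sqrt.continuousOn.sub ?_)
    exact Real.continuous_sqrt.continuousOn.inv₀ fun t ht => (Real.sqrt_pos.2 (by linarith [ht.1])).ne'
  have hder : ∀ p ∈ R₄.domain, ∀ t ∈ Ioo (a p) (b p),
      HasDerivAt (fun u : ℝ => F (Fin.snoc p u)) (Rb.integrand (Fin.snoc p t)) t := by
    intro p hp t ht
    have hap := (ha01 p hp).1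
    have ht0 : 0 < t := by linarith [ht.1]
    have hmemt : (Fin.snoc p t : Fin 2 → ℝ) ∈ Rb.domain := by
      rw [hmem]
      simp only [hsnoc0, hsnoc1, Fin.init_snoc]
      exact ⟨hbase p hp, ht.1.le, by simpa [hb] using ht.2.le⟩
    rw [hbi hmemt]
    simp only [hF, hsnoc0, hsnoc1]
    have hst : 0 < Real.sqrt t := Real.sqrt_pos.2 ht0
    have h1 : HasDerivAt (fun u : ℝ => Real.sqrt u) (1 / (2 * Real.sqrt t)) t := Real.hasDerivAt_sqrt ht0.ne'
    have h2 : HasDerivAt (fun u : ℝ => (Real.sqrt u)⁻¹) (-(1 / (2 * Real.sqrt t)) / (Real.sqrt t) ^ 2) t :=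
      h1.inv hst.ne'
    have h3 := ((h1.sub h2).const_mul (3:ℝ)).div_const (Real.sqrt (1 - p 0 ^ 2))
    refine h3.congr_deriv ?_
    have hsqne : Real.sqrt (1 - p 0 ^ 2) ≠ 0 := (hsq p hp).ne'
    have hsqt : Real.sqrt t ^ 2 = t := Real.sq_sqrt ht0.le
    field_simp
    nlinarith [hsqt, Real.mul_self_sqrt ht0.le]
  -- (8) the base integrand is the difference of the boundary values
  have hbase_int : ∀ p ∈ R₄.domain, R₄.integrand p = F (Fin.snoc p (b p)) - F (Fin.snoc p (a p)) := by
    intro p hp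
    rw [h4i hp]
    simp only [hF, hsnoc0, hsnoc1, hb, Real.sqrt_one, inv_one, sub_self, mul_zero, zero_div, zero_sub]
    obtain ⟨hs1, hs2⟩ := sqrt_rpow_two_thirds (hm01 p hp).1
    simp only [ha]
    rw [hs2, hs1]
    simp only [hm]
    ring
  -- the move
  have hNL : of Rb - of R₄ ∈ newtonLeibnizRel :=
    ⟨1, Rb, R₄, a, b, F, hFsa, hasa, hbsa, fun p hp => (ha01 p hp).2, by
      rw [hbd, h4d], hcont, hder, hbase_int, rfl⟩
  exact newtonLeibnizRel_subset_relations hNL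

end Summit.KontsevichZagierPeriods.KontsevichZagierPeriods.Theorems.GKZLevelThree

end
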